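import Summits.ABC.IUTFork.Cor312ProvKIdeles
import Summits.ABC.IUTFork.Cor312LicenceShallowRealising
import Literature.IUT.LogVolume.GenuineSupportPrimesBound
import Literature.IUT.LogVolume.Corollary22TwoAdicIntegrality
import Literature.IUT.LogVolume.Theorem110GenuineStepIIPinned
import Literature.NumberTheory.DiophantineGeometry.AbcWave0UniformABCProofs
import Literature.IUT.LogVolume.Corollary22LegendreDeepAdmissiblePairs
import HarnessLib

/-!
# The CHOSEN realising q-idele of the `K`-level pilot datum: its norm at a bad place `x₀ | p` is `p^{ord_{x₀}(j_E)/(2l·e(x₀|p))}`,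
# and for a RATIONAL `j`-invariant `p^{ord_p(j_E)/(2l)}` — the ramification CANCELS (brick (H4) of abc-iut-C-cert-1's «HEX-KERNEL» sizing)

PROOF-ONLY support piece (D-0012; 0 definitions, 0 `Prop` facts) of the abc-iut cell (WAVE-4 D-0067 prover abc-iut-w4-d026, gen 5;
brick (H4) of abc-iut-C-cert-1's 2026-08-26T10:57:55Z sizing of the ONE remaining input `hex` of
`Conditional.not_hSH_v6K_of_exists_deep` (p438886): «at the datum of `P = ratPoint λ_k` the CHOSEN realising q-idele at any `x₀ | 7` has
`‖t_q(x₀)‖ = 7^{−k/l}` exactly — the ramification cancels»). TAKES NO SIDE on [IUTchIII] Cor. 3.12 or on any author; classical valuation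
bookkeeping on OUR typed objects (abc-iut-C-cert-3's `Cor312Prov.pilotDataOfK`, its CHOSEN q-ideles `(exists_realising_qIdeles_pilotDataOfK D).choose`).

WHAT IS PROVED (namespace `Summit.ABC.IUTFork.Cor312Prov`; `D : InitialThetaData F K F̄ E l Pb`, `X := pilotDataOfK D K`, `w := placeOf X p x₀`
the place of `K` carrying the fibre point `x₀ | p`, `tq := (exists_realising_qIdeles_pilotDataOfK D).choose`):
* `norm_chosenQIdele_eq_rpow_ord_jE` — at a BAD place (`w ∈ X.S`): `‖t_q(x₀)‖ = p^{ord_w(j_E)/(2l·e_w)}` with `ord_w(j_E) = ord K w (algebraMap F K E.j) < 0`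
  and `e_w = ramIdx K w = e(w|p)`: the realising normalisation `log‖t_{q,w}‖ = −P_q(w)·ln|κ(w)|/n_w` (Dupuy–Hilado (3.4); abc-iut-w5-d236
  `norm_qIdele_eq_rpow_of_realises`) with `P_q(w) = ord_w(q)/(2l)` and `ord_w(q) := −ord_w(j_E)` (abc-iut-c312-3 `PilotData.ordq`).
* `norm_chosenQIdele_eq_rpow_ord_rat` — if moreover `j_E = j₀ ∈ ℚ` (the `λ`-line data of [IUTchIV] Cor. 2.2: `T.j_eq` at `P = ratPoint λ`,
  `P.F = ℚ`), then `‖t_q(x₀)‖ = p^{ord_u(j₀)/(2l·ord_u(p))}` for the place `u` of `ℚ` under `w` — NO ramification index of the (opaque) field `K`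
  remains: `ord_w(j₀) = e(w|u)·ord_u(j₀)` and `e_w = ord_w(p) = e(w|u)·ord_u(p)` (the tree's `Cor22.ord_algebraMap_eq`, `Cor22.ord_natCast_eq_ramIdx`);
  `ord_u(p) = 1` for the place of `ℚ` over `p`, kept symbolic here (`𝓞 ℚ`-bookkeeping).
* `norm_chosenQIdele_lt_one` / `norm_chosenQIdele_le_rpow_of_ord_le` — the depth forms consumed by (H5): at a bad place `‖t_q(x₀)‖ < 1`,
  and for rational `j₀` with `ord_u(j₀) ≤ −h` (`h ≥ 0`), `‖t_q(x₀)‖ ≤ p^{−h/(2l·ord_u(p))}`.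
* §2 `placeOf_mem_S_of_isP5Choice` — WHICH fibre points are bad: for a datum whose `𝕍^bad_mod` is the (P5) choice (`ThetaData.IsP5Choice`,
  [IUTchIV] Cor. 2.2 (ii) proof p. 46) and `j(E) = j(λ)` (`ThetaVolumeDatumAt.j_eq`), every `x₀ | p` with `p ≠ 2, l` over a pole of `j(λ)` is in
  `S` (semistability of Def. 3.1 (b) + campaign-S `Cor22.hasMultiplicativeReductionAt_of_isSemistable_of_j_eq`); `natGenerator_finBelow_placeOf`.
* §3 `norm_chosenQIdele_le_rpow_of_ratPoint` — the (H4) package at `P = ratPoint λ`: if `j(λ)` has a pole of order `≥ h ≥ 1` at `p ≠ 2, l`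
  (`∀ u, natGenerator u = p → ord_u(j(λ)) ≤ −h`; for `λ_k = 1/2 + 2/7^k`, `p = 7`, `h = 2k`), then EVERY `x₀ | p` is bad and
  `‖t_q(x₀)‖ ≤ p^{−h/(2l·ord_u(p))}`.
LEFT SYMBOLIC: `ord_u(p) = 1` for the place `u` of `𝓞 ℚ` over `p` (value `ramIdx ℚ u`; campaign-S `UniformABCConjecture.asIdeal_eq_span_natGenerator`
route) — it only enters as the harmless denominator above (`ord_u(p) ≥ 1` is used and proved inline).
HONEST SCOPE: nothing here decides whether a given `x₀ | p` IS bad for the datum (that is `T.isP5Choice` + semistability + `ord(j) < 0`, brick of the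
assembly), nor bounds `d, a, b` of `K_{x₀}` ((H1)–(H3)); typed ≠ proved for everything disputed; no side taken on [IUTchIII] Cor. 3.12.
[cite: DupuyHilado2025, §3.3, §3.4] [cite: Mochizuki2012, IUTchI Ex. 3.2 (iv) p. 71; IUTchIV Cor. 2.2 (ii) p. 46] [cite: NeukirchANT1999, Ch. I (8.2)]
-/

noncomputable section

open NumberField IsDedekindDomain

namespace Summit.ABC.IUTFork.Cor312Prov

open Literature.IUT.LogVolume Literature.IUT.HodgeTheaters Thm311.Real
open Literature.NumberTheory.DiophantineGeometry.GenEll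

variable {F K Fbar : Type} [Field F] [NumberField F] [Field K] [NumberField K] [Algebra F K] [Field Fbar]
  [Algebra F Fbar] [Algebra K Fbar] {E : WeierstrassCurve F} [E.IsElliptic] {l : ℕ} {Pb : BadPlacePredicates K}
  (D : InitialThetaData F K Fbar E l Pb)

/-- **`‖t_q(x₀)‖ = p^{ord_w(j_E)/(2l·e_w)}` for the CHOSEN realising q-idele at a bad place `w = placeOf X p x₀ ∈ S`** (`X = pilotDataOfK D K`;
`ord_w(j_E) < 0`, `e_w = e(w|p)`): Dupuy–Hilado's realising normalisation (3.4) read through `P_q(w) = ord_w(q)/(2l)`, `ord_w(q) = −ord_w(j_E)`.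
[cite: DupuyHilado2025, §3.3, §3.4] -/
theorem norm_chosenQIdele_eq_rpow_ord_jE (pp : Nat.Primes) (x₀ : (thetaIndex (pilotDataOfK D K)).Fibre (.inr pp))
    (hw : haveI : Fact (pp : ℕ).Prime := ⟨pp.2⟩; placeOf (pilotDataOfK D K) pp.1 x₀ ∈ (pilotDataOfK D K).S) :
    haveI : Fact (pp : ℕ).Prime := ⟨pp.2⟩
    ‖(exists_realising_qIdeles_pilotDataOfK D).choose pp x₀‖ =
      ((pp : ℕ) : ℝ) ^ ((ord K (placeOf (pilotDataOfK D K) pp.1 x₀) (algebraMap F K E.j) : ℝ) /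
        (2 * l * ramIdx K (placeOf (pilotDataOfK D K) pp.1 x₀))) := by
  haveI : Fact (pp : ℕ).Prime := ⟨pp.2⟩
  rw [norm_qIdele_eq_rpow_of_realises (pilotDataOfK D K) (exists_realising_qIdeles_pilotDataOfK D).choose
    (exists_realising_qIdeles_pilotDataOfK D).choose_spec.1 (exists_realising_qIdeles_pilotDataOfK D).choose_spec.2.2 pp x₀,
    (pilotDataOfK D K).qPilot_apply_of_mem hw, pilotDataOfK_l]
  congr 1
  unfold PilotData.ordq
  rw [show (pilotDataOfK D K).jE = algebraMap F K E.j from rfl]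
  push_cast
  ring

/-- **`‖t_q(x₀)‖ < 1` at a bad place** (`ord_w(j_E) < 0`, `e_w ≥ 1`). [cite: DupuyHilado2025, §3.3, §3.4] -/
theorem norm_chosenQIdele_lt_one (pp : Nat.Primes) (x₀ : (thetaIndex (pilotDataOfK D K)).Fibre (.inr pp))
    (hw : haveI : Fact (pp : ℕ).Prime := ⟨pp.2⟩; placeOf (pilotDataOfK D K) pp.1 x₀ ∈ (pilotDataOfK D K).S) :
    haveI : Fact (pp : ℕ).Prime := ⟨pp.2⟩
    ‖(exists_realising_qIdeles_pilotDataOfK D).choose pp x₀‖ < 1 := by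
  haveI : Fact (pp : ℕ).Prime := ⟨pp.2⟩
  have hp1 : (1 : ℝ) < ((pp : ℕ) : ℝ) := by exact_mod_cast pp.2.one_lt
  have hl : 0 < l := lt_of_lt_of_le (by norm_num) D.five_le_l
  have he : 0 < ramIdx K (placeOf (pilotDataOfK D K) pp.1 x₀) := Nat.pos_of_ne_zero (ramIdx_ne_zero K _)
  have hj : ord K (placeOf (pilotDataOfK D K) pp.1 x₀) (algebraMap F K E.j) < 0 := by
    have h := (pilotDataOfK D K).ord_jE_neg _ hw
    rwa [show (pilotDataOfK D K).jE = algebraMap F K E.j from rfl] at h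
  rw [norm_chosenQIdele_eq_rpow_ord_jE D pp x₀ hw]
  refine Real.rpow_lt_one_of_one_lt_of_neg hp1 (div_neg_of_neg_of_pos (by exact_mod_cast hj) ?_)
  have : (0 : ℝ) < (l : ℝ) := by exact_mod_cast hl
  have : (0 : ℝ) < (ramIdx K (placeOf (pilotDataOfK D K) pp.1 x₀) : ℝ) := by exact_mod_cast he
  positivity

/-- **Rational `j`-invariant: the ramification CANCELS.** If `E.j = j₀ ∈ ℚ` (the `λ`-line data of [IUTchIV] Cor. 2.2 (ii): `ThetaVolumeDatumAt.j_eq`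
at `P = ratPoint λ`, whose `P.F` is `ℚ`), then at a bad place `x₀ | p`: `‖t_q(x₀)‖ = p^{ord_u(j₀)/(2l·ord_u(p))}`, `u` the place of `ℚ` under
`w = placeOf X p x₀` — by `ord_w(j₀) = e(w|u)·ord_u(j₀)` and `e_w = ord_w(p) = e(w|u)·ord_u(p)`. (`ord_u(p) = 1`; kept symbolic.)
[cite: NeukirchANT1999, Ch. I (8.2)] [cite: DupuyHilado2025, §3.4] -/
theorem norm_chosenQIdele_eq_rpow_ord_rat (pp : Nat.Primes) (x₀ : (thetaIndex (pilotDataOfK D K)).Fibre (.inr pp))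
    (hw : haveI : Fact (pp : ℕ).Prime := ⟨pp.2⟩; placeOf (pilotDataOfK D K) pp.1 x₀ ∈ (pilotDataOfK D K).S)
    (j₀ : ℚ) (hj : E.j = (j₀ : F)) :
    haveI : Fact (pp : ℕ).Prime := ⟨pp.2⟩
    ‖(exists_realising_qIdeles_pilotDataOfK D).choose pp x₀‖ =
      ((pp : ℕ) : ℝ) ^ ((ord ℚ (finBelow ℚ K (placeOf (pilotDataOfK D K) pp.1 x₀)) j₀ : ℝ) /
        (2 * l * ord ℚ (finBelow ℚ K (placeOf (pilotDataOfK D K) pp.1 x₀)) ((pp : ℕ) : ℚ))) := by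
  haveI : Fact (pp : ℕ).Prime := ⟨pp.2⟩
  set w := placeOf (pilotDataOfK D K) pp.1 x₀ with hwdef
  rw [norm_chosenQIdele_eq_rpow_ord_jE D pp x₀ hw]
  congr 1
  -- `ord_w(j₀) = e(w|u)·ord_u(j₀)` and `e_w = ord_w(p) = e(w|u)·ord_u(p)`
  have hjK : algebraMap F K E.j = algebraMap ℚ K j₀ := by
    rw [hj, map_ratCast, eq_ratCast]
  have h1 : ord K w (algebraMap F K E.j) =
      ((finBelow ℚ K w).asIdeal.ramificationIdx' w.asIdeal : ℤ) * ord ℚ (finBelow ℚ K w) j₀ := by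
    rw [hjK, Cor22.ord_algebraMap_eq]
  have h2 : (ramIdx K w : ℤ) = ((finBelow ℚ K w).asIdeal.ramificationIdx' w.asIdeal : ℤ) * ord ℚ (finBelow ℚ K w) ((pp : ℕ) : ℚ) := by
    rw [← Cor22.ord_natCast_eq_ramIdx (pp : ℕ) w (placeOf_mem (pilotDataOfK D K) pp.1 x₀),
      show ((pp : ℕ) : K) = algebraMap ℚ K ((pp : ℕ) : ℚ) from (map_natCast (algebraMap ℚ K) pp).symm,
      Cor22.ord_algebraMap_eq]
  have he0 : ((finBelow ℚ K w).asIdeal.ramificationIdx' w.asIdeal : ℝ) ≠ 0 := by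
    exact_mod_cast Ideal.IsDedekindDomain.ramificationIdx'_ne_zero_of_liesOver w.asIdeal (finBelow ℚ K w).ne_bot
  have h2R : (ramIdx K w : ℝ) = ((finBelow ℚ K w).asIdeal.ramificationIdx' w.asIdeal : ℝ) * (ord ℚ (finBelow ℚ K w) ((pp : ℕ) : ℚ) : ℝ) := by
    exact_mod_cast h2
  rw [h1, h2R]
  push_cast
  rw [mul_comm ((finBelow ℚ K w).asIdeal.ramificationIdx' w.asIdeal : ℝ) (ord ℚ (finBelow ℚ K w) j₀ : ℝ),
    show (2 : ℝ) * (l : ℝ) * (((finBelow ℚ K w).asIdeal.ramificationIdx' w.asIdeal : ℝ) * (ord ℚ (finBelow ℚ K w) ((pp : ℕ) : ℚ) : ℝ)) =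
      (2 * (l : ℝ) * (ord ℚ (finBelow ℚ K w) ((pp : ℕ) : ℚ) : ℝ)) * ((finBelow ℚ K w).asIdeal.ramificationIdx' w.asIdeal : ℝ) by ring,
    mul_div_mul_right _ _ he0]

/-- **Depth form for (H5)**: with a rational `j`-invariant of `p`-order `≤ −h` (`h ≥ 0`; for `λ_k = 1/2 + 2/7^k`: `p = 7`, `h = 2k`) at a bad place
`x₀ | p`, `‖t_q(x₀)‖ ≤ p^{−h/(2l·ord_u(p))}` (`= p^{−h/(2l)}` as `ord_u(p) = 1`). [cite: DupuyHilado2025, §3.4]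
[cite: Mochizuki2012, IUTchIV Cor. 2.2 (ii) p. 46] -/
theorem norm_chosenQIdele_le_rpow_of_ord_le (pp : Nat.Primes) (x₀ : (thetaIndex (pilotDataOfK D K)).Fibre (.inr pp))
    (hw : haveI : Fact (pp : ℕ).Prime := ⟨pp.2⟩; placeOf (pilotDataOfK D K) pp.1 x₀ ∈ (pilotDataOfK D K).S)
    (j₀ : ℚ) (hj : E.j = (j₀ : F)) (h : ℕ)
    (hord : haveI : Fact (pp : ℕ).Prime := ⟨pp.2⟩; ord ℚ (finBelow ℚ K (placeOf (pilotDataOfK D K) pp.1 x₀)) j₀ ≤ -(h : ℤ)) :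
    haveI : Fact (pp : ℕ).Prime := ⟨pp.2⟩
    ‖(exists_realising_qIdeles_pilotDataOfK D).choose pp x₀‖ ≤
      ((pp : ℕ) : ℝ) ^ (-(h : ℝ) / (2 * l * ord ℚ (finBelow ℚ K (placeOf (pilotDataOfK D K) pp.1 x₀)) ((pp : ℕ) : ℚ))) := by
  haveI : Fact (pp : ℕ).Prime := ⟨pp.2⟩
  set w := placeOf (pilotDataOfK D K) pp.1 x₀ with hwdef
  have hp1 : (1 : ℝ) ≤ ((pp : ℕ) : ℝ) := by exact_mod_cast pp.2.one_lt.le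
  have hl : 0 < l := lt_of_lt_of_le (by norm_num) D.five_le_l
  -- `ord_u(p) ≥ 1`: `e_w = e(w|u)·ord_u(p)` with `e_w, e(w|u) ≥ 1` and `ord_u(p) ∈ ℤ`
  have hop : 0 < ord ℚ (finBelow ℚ K w) ((pp : ℕ) : ℚ) := by
    have h2 : (ramIdx K w : ℤ) = ((finBelow ℚ K w).asIdeal.ramificationIdx' w.asIdeal : ℤ) * ord ℚ (finBelow ℚ K w) ((pp : ℕ) : ℚ) := by
      rw [← Cor22.ord_natCast_eq_ramIdx (pp : ℕ) w (placeOf_mem (pilotDataOfK D K) pp.1 x₀),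
        show ((pp : ℕ) : K) = algebraMap ℚ K ((pp : ℕ) : ℚ) from (map_natCast (algebraMap ℚ K) pp).symm,
        Cor22.ord_algebraMap_eq]
    have he : 0 < (ramIdx K w : ℤ) := by exact_mod_cast Nat.pos_of_ne_zero (ramIdx_ne_zero K w)
    have he' : 0 ≤ ((finBelow ℚ K w).asIdeal.ramificationIdx' w.asIdeal : ℤ) := by positivity
    rw [h2] at he
    exact pos_of_mul_pos_right he he'
  rw [norm_chosenQIdele_eq_rpow_ord_rat D pp x₀ hw j₀ hj]
  refine Real.rpow_le_rpow_of_exponent_le hp1 (div_le_div_of_nonneg_right ?_ ?_)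
  · exact_mod_cast hord
  · have : (0 : ℝ) < (l : ℝ) := by exact_mod_cast hl
    have : (0 : ℝ) < (ord ℚ (finBelow ℚ K w) ((pp : ℕ) : ℚ) : ℝ) := by exact_mod_cast hop
    positivity

/-! ## §2. Which fibre points are BAD: the (P5) choice over a λ-line point -/

/-- **Every fibre point `x₀ | p` over a pole of `j(λ)` with `p ≠ 2, l` is a BAD place of the `K`-level pilot datum** of a Θ-volume datum whose
`𝕍^bad_mod` is the (P5) choice ([IUTchIV] Cor. 2.2 (ii) proof p. 46: the places not dividing `2l` of multiplicative reduction) and whose curve has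
`j(E) = j(λ)`: the place `v` of `F` under `w = placeOf X p x₀` lies over a bad place of `λ`, so `E` (semistable, [IUTchI] Def. 3.1 (b)) has
multiplicative reduction there (campaign-S `Cor22.hasMultiplicativeReductionAt_of_isSemistable_of_j_eq`), and `v ∤ 2l` since `v | p ≠ 2, l`.
[cite: Mochizuki2012, IUTchIV Cor. 2.2 (ii) proof (P5) p. 46; IUTchI Def. 3.1 (b) p. 61] [cite: SilvermanAEC2009, Prop. VII.5.1] -/
theorem placeOf_mem_S_of_isP5Choice {P : NFPoint} [Algebra P.F F] (hj : E.j = algebraMap P.F F (Cor22.jInv P.x))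
    (hP5 : ThetaData.IsP5Choice D) (pp : Nat.Primes) (x₀ : (thetaIndex (pilotDataOfK D K)).Fibre (.inr pp))
    (h2 : (pp : ℕ) ≠ 2) (hl : (pp : ℕ) ≠ l)
    (hbad : haveI : Fact (pp : ℕ).Prime := ⟨pp.2⟩
      finBelow P.F F (finBelow F K (placeOf (pilotDataOfK D K) pp.1 x₀)) ∈ Cor22.badPlaces P) :
    haveI : Fact (pp : ℕ).Prime := ⟨pp.2⟩
    placeOf (pilotDataOfK D K) pp.1 x₀ ∈ (pilotDataOfK D K).S := by
  haveI : Fact (pp : ℕ).Prime := ⟨pp.2⟩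
  set w := placeOf (pilotDataOfK D K) pp.1 x₀ with hwdef
  rw [mem_pilotDataOfK_S_iff]
  refine (hP5 _).mpr ⟨?_, ?_⟩
  · intro p' hp' hmem
    rw [FinitePlace.maximalIdeal_mk] at hmem
    have hpv : ((pp : ℕ) : 𝓞 F) ∈ (finBelow F K w).asIdeal := by
      change ((pp : ℕ) : 𝓞 F) ∈ Ideal.comap (algebraMap (𝓞 F) (𝓞 K)) w.asIdeal
      rw [Ideal.mem_comap, map_natCast]
      exact natCast_mem_placeOf (pilotDataOfK D K) pp.1 x₀
    have hp'prime : p'.Prime := by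
      rcases Finset.mem_insert.mp hp' with rfl | hp'
      · exact Nat.prime_two
      · rw [Finset.mem_singleton.mp hp']; exact D.l_prime
    have hpeq : p' = (pp : ℕ) := eq_of_natCast_mem_of_prime (pp : ℕ) (finBelow F K w).isPrime.ne_top hp'prime hmem hpv
    rcases Finset.mem_insert.mp hp' with h | h
    · exact h2 (hpeq ▸ h)
    · exact hl (hpeq ▸ Finset.mem_singleton.mp h)
  · rw [FinitePlace.maximalIdeal_mk]
    exact Cor22.hasMultiplicativeReductionAt_of_isSemistable_of_j_eq F D.isSemistable hj _ hbad

/-- The place of `ℚ` under a fibre point `x₀ | p` is the place of `p`: its `natGenerator` is `p`. [folklore] -/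
theorem natGenerator_finBelow_placeOf (pp : Nat.Primes) (x₀ : (thetaIndex (pilotDataOfK D K)).Fibre (.inr pp)) :
    haveI : Fact (pp : ℕ).Prime := ⟨pp.2⟩
    Rat.HeightOneSpectrum.natGenerator (finBelow ℚ K (placeOf (pilotDataOfK D K) pp.1 x₀)) = (pp : ℕ) := by
  haveI : Fact (pp : ℕ).Prime := ⟨pp.2⟩
  have hmem : ((pp : ℕ) : 𝓞 ℚ) ∈ (finBelow ℚ K (placeOf (pilotDataOfK D K) pp.1 x₀)).asIdeal := by
    change ((pp : ℕ) : 𝓞 ℚ) ∈ Ideal.comap (algebraMap (𝓞 ℚ) (𝓞 K)) (placeOf (pilotDataOfK D K) pp.1 x₀).asIdeal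
    rw [Ideal.mem_comap, map_natCast]
    exact natCast_mem_placeOf (pilotDataOfK D K) pp.1 x₀
  exact (Nat.prime_dvd_prime_iff_eq (Rat.HeightOneSpectrum.prime_natGenerator _) pp.2).mp
    ((Literature.NumberTheory.DiophantineGeometry.UniformABCConjecture.natCast_mem_asIdeal_iff _ _).mp hmem)

/-! ## §3. At a λ-line point: `‖t_q(x₀)‖ ≤ p^{−h/(2l·ord_u(p))}` from a pole of `j(λ)` of order `≥ h` at `p ≠ 2, l` -/

/-- **(H4) at a `λ`-line point.** For a Θ-volume datum over `P = ratPoint λ` (`j(E) = j(λ)` read in `F`, `𝕍^bad_mod` the (P5) choice) and a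
prime `p ≠ 2, l` at which `j(λ)` has a pole of order `≥ h ≥ 1` (for `λ_k = 1/2 + 2/7^k`: `p = 7`, `h = 2k`, campaign-S
`Cor22.exists_ratPoint_mem_std_two` / its order computation), EVERY fibre point `x₀ | p` of the `K`-level pilot datum is BAD and the CHOSEN realising
q-idele there has `‖t_q(x₀)‖ ≤ p^{−h/(2l·ord_u(p))}` (`u` the place of `ℚ` over `p`; `ord_u(p) = 1`) — no ramification index of the opaque `K`.
[cite: Mochizuki2012, IUTchIV Cor. 2.2 (ii) proof (P5) p. 46] [cite: DupuyHilado2025, §3.4] -/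
theorem norm_chosenQIdele_le_rpow_of_ratPoint (q : ℚ) [Algebra (ratPoint q).F F]
    (hj : E.j = algebraMap (ratPoint q).F F (Cor22.jInv (ratPoint q).x)) (hP5 : ThetaData.IsP5Choice D)
    (pp : Nat.Primes) (x₀ : (thetaIndex (pilotDataOfK D K)).Fibre (.inr pp)) (h2 : (pp : ℕ) ≠ 2) (hl : (pp : ℕ) ≠ l)
    (h : ℕ) (hh : 1 ≤ h)
    (hord : ∀ u : HeightOneSpectrum (𝓞 ℚ), Rat.HeightOneSpectrum.natGenerator u = (pp : ℕ) → ord ℚ u (Cor22.jInv q) ≤ -(h : ℤ)) :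
    haveI : Fact (pp : ℕ).Prime := ⟨pp.2⟩
    placeOf (pilotDataOfK D K) pp.1 x₀ ∈ (pilotDataOfK D K).S ∧
    ‖(exists_realising_qIdeles_pilotDataOfK D).choose pp x₀‖ ≤
      ((pp : ℕ) : ℝ) ^ (-(h : ℝ) / (2 * l * ord ℚ (finBelow ℚ K (placeOf (pilotDataOfK D K) pp.1 x₀)) ((pp : ℕ) : ℚ))) := by
  haveI : Fact (pp : ℕ).Prime := ⟨pp.2⟩
  set w := placeOf (pilotDataOfK D K) pp.1 x₀ with hwdef
  have h1 : (1 : ℤ) ≤ h := by exact_mod_cast hh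
  have hq0 : Cor22.jInv q ≠ 0 := by
    intro h0
    have := hord (finBelow ℚ K w) (natGenerator_finBelow_placeOf D pp x₀)
    rw [h0, ord_zero] at this
    omega
  -- the place of `ℚ = (ratPoint q).F` under the place of `F` under `w`: generator `p`, hence a pole of `j(λ)`
  set u' : HeightOneSpectrum (𝓞 ℚ) := finBelow (ratPoint q).F F (finBelow F K w) with hu'
  have hgenF : ((pp : ℕ) : 𝓞 (ratPoint q).F) ∈ (finBelow (ratPoint q).F F (finBelow F K w)).asIdeal := by
    change ((pp : ℕ) : 𝓞 (ratPoint q).F) ∈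
      Ideal.comap (algebraMap (𝓞 (ratPoint q).F) (𝓞 F)) (Ideal.comap (algebraMap (𝓞 F) (𝓞 K)) w.asIdeal)
    rw [Ideal.mem_comap, Ideal.mem_comap, map_natCast, map_natCast]
    exact natCast_mem_placeOf (pilotDataOfK D K) pp.1 x₀
  have hgenQ : ((pp : ℕ) : 𝓞 ℚ) ∈ u'.asIdeal := by
    unfold ratPoint at hgenF
    exact hgenF
  have hgen : Rat.HeightOneSpectrum.natGenerator u' = (pp : ℕ) :=
    (Nat.prime_dvd_prime_iff_eq (Rat.HeightOneSpectrum.prime_natGenerator _) pp.2).mp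
      ((Literature.NumberTheory.DiophantineGeometry.UniformABCConjecture.natCast_mem_asIdeal_iff _ _).mp hgenQ)
  have hlt : ord ℚ u' (Cor22.jInv q) < 0 := lt_of_le_of_lt (hord u' hgen) (by omega)
  have hbad : finBelow (ratPoint q).F F (finBelow F K w) ∈ Cor22.badPlaces (ratPoint q) := by
    unfold Cor22.badPlaces
    rw [Set.Finite.mem_toFinset]
    exact (ord_neg_iff_one_lt_valuation ℚ u' hq0).mp hlt
  have hw : w ∈ (pilotDataOfK D K).S := placeOf_mem_S_of_isP5Choice D hj hP5 pp x₀ h2 hl hbad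
  refine ⟨hw, ?_⟩
  have hjF : E.j = ((Cor22.jInv q : ℚ) : F) := by rw [hj]; exact eq_ratCast _ _
  exact norm_chosenQIdele_le_rpow_of_ord_le D pp x₀ hw (Cor22.jInv q) hjF h (hord _ (natGenerator_finBelow_placeOf D pp x₀))

/-! ## §4 (v2, append-only). `ord_u(p) = 1` for the place of `ℚ` over `p` (abc-iut-w5-d044 `Cor22.ord_natGenerator_eq_one`, brick H0):
the clean forms `p^{ord_u(j₀)/(2l)}`, `p^{−h/(2l)}` -/

/-- `ord_u(p) = 1` for the place `u` of `ℚ` under a fibre point `x₀ | p`. [folklore] -/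
theorem ord_rat_finBelow_placeOf_eq_one (pp : Nat.Primes) (x₀ : (thetaIndex (pilotDataOfK D K)).Fibre (.inr pp)) :
    haveI : Fact (pp : ℕ).Prime := ⟨pp.2⟩
    ord ℚ (finBelow ℚ K (placeOf (pilotDataOfK D K) pp.1 x₀)) ((pp : ℕ) : ℚ) = 1 := by
  haveI : Fact (pp : ℕ).Prime := ⟨pp.2⟩
  have h := Cor22.ord_natGenerator_eq_one (finBelow ℚ K (placeOf (pilotDataOfK D K) pp.1 x₀))
  rwa [natGenerator_finBelow_placeOf D pp x₀] at h

/-- **Rational `j`-invariant, clean form: `‖t_q(x₀)‖ = p^{ord_u(j₀)/(2l)}`** at a bad place `x₀ | p` — no ramification, no denominator.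
[cite: DupuyHilado2025, §3.4] [cite: NeukirchANT1999, Ch. I (8.2)] -/
theorem norm_chosenQIdele_eq_rpow_ord_rat' (pp : Nat.Primes) (x₀ : (thetaIndex (pilotDataOfK D K)).Fibre (.inr pp))
    (hw : haveI : Fact (pp : ℕ).Prime := ⟨pp.2⟩; placeOf (pilotDataOfK D K) pp.1 x₀ ∈ (pilotDataOfK D K).S)
    (j₀ : ℚ) (hj : E.j = (j₀ : F)) :
    haveI : Fact (pp : ℕ).Prime := ⟨pp.2⟩
    ‖(exists_realising_qIdeles_pilotDataOfK D).choose pp x₀‖ =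
      ((pp : ℕ) : ℝ) ^ ((ord ℚ (finBelow ℚ K (placeOf (pilotDataOfK D K) pp.1 x₀)) j₀ : ℝ) / (2 * l)) := by
  haveI : Fact (pp : ℕ).Prime := ⟨pp.2⟩
  rw [norm_chosenQIdele_eq_rpow_ord_rat D pp x₀ hw j₀ hj, ord_rat_finBelow_placeOf_eq_one D pp x₀, Int.cast_one, mul_one]

/-- **(H4) at a `λ`-line point, clean form: every `x₀ | p` is bad and `‖t_q(x₀)‖ ≤ p^{−h/(2l)}`** (pole of `j(λ)` of order `≥ h ≥ 1` at
`p ≠ 2, l`; for `λ_k = 1/2 + 2/7^k`: `p = 7`, `h = 2k`, i.e. `‖t_q(x₀)‖ ≤ 7^{−k/l}`). [cite: Mochizuki2012, IUTchIV Cor. 2.2 (ii) proof (P5) p. 46]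
[cite: DupuyHilado2025, §3.4] -/
theorem norm_chosenQIdele_le_rpow_of_ratPoint' (q : ℚ) [Algebra (ratPoint q).F F]
    (hj : E.j = algebraMap (ratPoint q).F F (Cor22.jInv (ratPoint q).x)) (hP5 : ThetaData.IsP5Choice D)
    (pp : Nat.Primes) (x₀ : (thetaIndex (pilotDataOfK D K)).Fibre (.inr pp)) (h2 : (pp : ℕ) ≠ 2) (hl : (pp : ℕ) ≠ l)
    (h : ℕ) (hh : 1 ≤ h)
    (hord : ∀ u : HeightOneSpectrum (𝓞 ℚ), Rat.HeightOneSpectrum.natGenerator u = (pp : ℕ) → ord ℚ u (Cor22.jInv q) ≤ -(h : ℤ)) :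
    haveI : Fact (pp : ℕ).Prime := ⟨pp.2⟩
    placeOf (pilotDataOfK D K) pp.1 x₀ ∈ (pilotDataOfK D K).S ∧
    ‖(exists_realising_qIdeles_pilotDataOfK D).choose pp x₀‖ ≤ ((pp : ℕ) : ℝ) ^ (-(h : ℝ) / (2 * l)) := by
  haveI : Fact (pp : ℕ).Prime := ⟨pp.2⟩
  have h := norm_chosenQIdele_le_rpow_of_ratPoint D q hj hP5 pp x₀ h2 hl h hh hord
  rw [ord_rat_finBelow_placeOf_eq_one D pp x₀, Int.cast_one, mul_one] at h
  exact h

end Summit.ABC.IUTFork.Cor312Prov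

end
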